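import Summits.CriticalPhenomena.SAWScalingLimit.Theorems.SAWLoopFugacityFlowAvoidanceLimitAnchorDefs
import Summits.CriticalPhenomena.SAWScalingLimit.Theorems.SAWLoopFugacityFlowAvoidanceLimitSawEndpoint
import Literature.Probability.LatticeModels.DiluteLoopModelAnalyticity

/-!
# Linear response of the strictly dilute loop gas in the loop fugacity at `n = 0` —
helper of the lever `stub_cornerLipschitz` of line `saw-corner-germ`
(crux `SAWLoopFugacityFlow.AvoidanceLimit`, stmt-CriticalPhenomena-10649)

The first finite-volume identity behind the corner lever (the card's `LinearResponseLaw`, ideator 3; the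
lead's assessment §1): for the tree's dilute loop model at collision weight `w = 0`,
`n ↦ Z_{n,0,x}(G, Λ; A)` is a polynomial in `n` whose derivative AT `n = 0` is the generating function of the
configurations with EXACTLY ONE closed loop and no collision vertex,
`∂ₙ Z_{n,0,x}(G, Λ; A)|_{n=0} = Σ_{F : N(F) = 0, loops(F) = 1} x^{|F|}`
(`hasDerivAt_partitionFunction_zero`). For `A = ∅` this is the polygon generating function `Π(G, Λ)` of
the domain — the `x`-mass of single self-avoiding polygons — and `Z_{0,0,x}(G, Λ; ∅) = 1`, so
`∂ₙ log Z_{n,0,x}(G, Λ; ∅)|₀ = Π(G, Λ)`: switching on an infinitesimal loop fugacity weighs each configuration by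
the mass of polygons it could host. Termwise: the weight of `(F, S)` is `x^{|F|} · 0^{N(F)} · n^{loops}`, the
factor `0^{N(F)}` kills every configuration with a collision vertex (and `S` then ranges over `{∅}`), and
`d/dn n^k|₀ = [k = 1]`.

Sources: W. Guo, H. W. J. Blöte, B. Nienhuis, Int. J. Mod. Phys. C 10 (1999) 301, §1 eq. (1) (the weights)
[GuoBloteNienhuis1999]; J. L. Jacobsen, *Conformal field theory applied to loop models*, LNP 775 (2009),
ch. 14, §14.3.1 (the `n → 0` limit; de Gennes 1972) [Jacobsen2009]. No new definitions; nothing about the scaling limit is asserted here.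
-/

noncomputable section

open Finset
open scoped symmDiff
open Literature.Probability.RandomPlanarGeometry Literature.Probability.LatticeModels
open Summit.CriticalPhenomena.SAWScalingLimit.Theorems.AvoidanceLimit.Anchor

namespace Summit.CriticalPhenomena.SAWScalingLimit.Theorems.AvoidanceLimit.Corner

/-- `d/dn (c · n^k)|_{n=0} = c · [k = 1]`. [folklore] -/
theorem hasDerivAt_const_mul_pow_zero (c : ℝ) (k : ℕ) :
    HasDerivAt (fun n : ℝ => c * n ^ k) (if k = 1 then c else 0) 0 := by
  have h := (hasDerivAt_pow k (0 : ℝ)).const_mul c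
  refine h.congr_deriv ?_
  rcases Nat.lt_trichotomy k 1 with hk | rfl | hk
  · have hk0 : k = 0 := by omega
    subst hk0
    simp
  · simp
  · have hne : k ≠ 1 := by omega
    have hk1 : k - 1 ≠ 0 := by omega
    rw [if_neg hne, zero_pow hk1]
    ring

/-- The weight of a resolved configuration at collision weight `w = 0`, as a function of the loop
fugacity: `x^{|F|} · 0^{N(F)} · n^{loops(F,S)}`. [cite: GuoBloteNienhuis1999, §1 eq. (1)] -/
theorem weight_collision_zero (n x : ℝ) (Λ : Finset (Site 2)) (F : Finset (Sym2 (Site 2)))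
    (S : Finset (Site 2)) :
    (⟨n, 0, x⟩ : DiluteLoopModel ℝ).weight Λ F S =
      x ^ #F * (0 : ℝ) ^ #(DiluteLoopModel.oscVerts Λ F) * n ^ DiluteLoopModel.loops Λ F S := rfl

/-- **Linear response in the loop fugacity at `n = 0`** (collision weight `w = 0`, any source set `A`):
`∂ₙ Z_{n,0,x}(G, Λ; A)|_{n=0} = Σ_{F ∈ configs, N(F) = 0, loops(F, ∅) = 1} x^{|F|}` — the configurations with
no collision vertex and exactly one closed loop. [cite: Jacobsen2009, §14.3.1 (the limit n → 0: one loop at first order in n)] -/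
theorem hasDerivAt_partitionFunction_zero :
    ∀ (H : SimpleGraph (Site 2)) [H.LocallyFinite] (x : ℝ) (Λ A : Finset (Site 2)),
      HasDerivAt (fun n : ℝ => (⟨n, 0, x⟩ : DiluteLoopModel ℝ).partitionFunction H Λ A)
        (∑ F ∈ (DiluteLoopModel.configs H Λ A).filter
          (fun F => DiluteLoopModel.oscVerts Λ F = ∅ ∧ DiluteLoopModel.loops Λ F ∅ = 1), x ^ #F) 0 := by
  intro H _ x Λ A
  classical
  -- termwise derivative
  have hterm : ∀ F ∈ DiluteLoopModel.configs H Λ A, ∀ S ∈ (DiluteLoopModel.oscVerts Λ F).powerset,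
      HasDerivAt (fun n : ℝ => (⟨n, 0, x⟩ : DiluteLoopModel ℝ).weight Λ F S)
        (if DiluteLoopModel.loops Λ F S = 1 then
          x ^ #F * (0 : ℝ) ^ #(DiluteLoopModel.oscVerts Λ F) else 0) 0 := by
    intro F _ S _
    have h := hasDerivAt_const_mul_pow_zero (x ^ #F * (0 : ℝ) ^ #(DiluteLoopModel.oscVerts Λ F))
      (DiluteLoopModel.loops Λ F S)
    simp only [weight_collision_zero]
    exact h
  have hsum : HasDerivAt (fun n : ℝ => (⟨n, 0, x⟩ : DiluteLoopModel ℝ).partitionFunction H Λ A)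
      (∑ F ∈ DiluteLoopModel.configs H Λ A, ∑ S ∈ (DiluteLoopModel.oscVerts Λ F).powerset,
        (if DiluteLoopModel.loops Λ F S = 1 then
          x ^ #F * (0 : ℝ) ^ #(DiluteLoopModel.oscVerts Λ F) else 0)) 0 := by
    have h := HasDerivAt.fun_sum (u := DiluteLoopModel.configs H Λ A)
      (A := fun F n => ∑ S ∈ (DiluteLoopModel.oscVerts Λ F).powerset,
        (⟨n, 0, x⟩ : DiluteLoopModel ℝ).weight Λ F S)
      (A' := fun F => ∑ S ∈ (DiluteLoopModel.oscVerts Λ F).powerset,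
        (if DiluteLoopModel.loops Λ F S = 1 then
          x ^ #F * (0 : ℝ) ^ #(DiluteLoopModel.oscVerts Λ F) else 0)) (x := (0 : ℝ))
      (fun F hF => HasDerivAt.fun_sum (hterm F hF))
    exact h
  refine hsum.congr_deriv ?_
  -- evaluate the double sum: the factor `0^{N(F)}` kills collisions, and then `S` ranges over `{∅}`
  rw [sum_filter]
  refine sum_congr rfl fun F _ => ?_
  by_cases hosc : DiluteLoopModel.oscVerts Λ F = ∅
  · rw [hosc, powerset_empty, sum_singleton]
    simp
  · have hpos : #(DiluteLoopModel.oscVerts Λ F) ≠ 0 := card_ne_zero.2 (nonempty_iff_ne_empty.2 hosc)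
    rw [if_neg (fun h => hosc h.1)]
    refine sum_eq_zero fun S _ => ?_
    simp [zero_pow hpos]

/-- **At `n = 0` the source-free partition function is `1`** on subgraphs of `ℤ²` (only the empty
configuration survives), so the linear response of `log Z(G, Λ; ∅)` at `n = 0` is the derivative itself:
the polygon generating function of the domain. [cite: GuoBloteNienhuis1999, §1 eq. (1)] -/
theorem hasDerivAt_log_partitionFunction_empty_zero :
    ∀ (H : SimpleGraph (Site 2)) [H.LocallyFinite], H ≤ zdGraph 2 → ∀ (x : ℝ) (Λ : Finset (Site 2)),
      HasDerivAt (fun n : ℝ => Real.log ((⟨n, 0, x⟩ : DiluteLoopModel ℝ).partitionFunction H Λ ∅))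
        (∑ F ∈ (DiluteLoopModel.configs H Λ ∅).filter
          (fun F => DiluteLoopModel.oscVerts Λ F = ∅ ∧ DiluteLoopModel.loops Λ F ∅ = 1), x ^ #F) 0 := by
  intro H _ hH x Λ
  have h1 : (⟨(0 : ℝ), 0, x⟩ : DiluteLoopModel ℝ).partitionFunction H Λ ∅ = 1 :=
    DiluteLoopModel.partitionFunction_zero_zero_empty hH x Λ
  have hd := hasDerivAt_partitionFunction_zero H x Λ ∅
  have hlog := HasDerivAt.log hd (by rw [h1]; exact one_ne_zero)
  simpa [h1] using hlog

end Summit.CriticalPhenomena.SAWScalingLimit.Theorems.AvoidanceLimit.Corner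

end
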